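import Literature.NumberTheory.Automorphic.ReductiveDualBruhat
import Literature.NumberTheory.Automorphic.RankOneBorelBruhat
import HarnessLib

/-!
# The Bruhat decomposition in semisimple rank one, discharged (Springer 7.2.2 (i))

This file proves the named fact `bruhat_rankOne_of_central` of `ReductiveDualBruhat.lean`
(Springer, *Linear Algebraic Groups*, 2nd ed., 7.2.2 (i) in the setting of 7.3.2 / 8.1.4 (i): for
`G ≤ GL n k` connected reductive over an algebraically closed field, `T` a maximal torus, `α` a
root with `(Ker α)°` central, `u` a root homomorphism for `α` and `m ∈ N_G(T) ∖ Z_G(T)`, every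
element of `G` outside `B = T · u(𝔾ₐ)` is `u(x) m t u(y)`) **unconditionally**:
`bruhat_rankOne_of_central_holds`.

Everything needed is already in the tree, in the `k`-points analysis of `G/B` for an *arbitrary*
Borel subgroup `B ⊇ T · U_α` (`RankOneBorel.lean`, `RankOneBorelBruhat.lean`, hypothesis
structure `RankOneBorelData G T B α u m ρ v`):

* a Borel subgroup `B ⊇ T · U_α` exists (2.2.7 (i) `isZConnected_sup`, 6.2 `exists_isBorelIn_ge`)
  and carries data `RankOneBorelData G T B α u m' ρ v` for *some* Weyl element `m'`
  (`exists_rankOneBorelData`: Chevalley 5.5.3, 6.2.7 (ii), 6.4.8 (ii), 7.6.3), whence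
  **`B = T · U_α`** (`RankOneBorelData.borel_eq_sup`, Springer 7.3.3 (ii) / 7.2.3 (i));
* the *given* `m ∈ N_G(T) ∖ Z_G(T)` is then outside `B = T · U_α` (an element `t u(x)`
  normalising `T` has `x = 0`, `IsRootHom.eq_zero_of_torus_mul_uval_mem_normalizer`), and
  `U_α ∩ m B m⁻¹ = {e}` (`eq_zero_of_conj_uval_mem`, from Chevalley's theorem 7.6.3 on the
  unipotent radical, `unipotent_eq_bot_of_forall_isBorelIn_le_holds`), so the same representation
  gives data `RankOneBorelData G T B α u m ρ v` for the given `m`;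
* `RankOneBorelData.bruhat` (7.2.2 (i): "*`G` is the disjoint union of `B` and `U n B`*") yields
  `g = u(y) m b` with `b = t u(x) ∈ B = T · U_α`.

## References

* [SpringerLAG1998] T. A. Springer, *Linear Algebraic Groups*, 2nd ed., Progress in Mathematics 9,
  Birkhäuser (1998): 7.2.2 (i), with 6.4.8 (ii), 7.2.3 (i), 7.3.3 (ii), 7.6.3.
-/

open scoped MatrixGroups IsMulCommutative

namespace Literature.NumberTheory.Automorphic

variable {k : Type*} [Field k] {n : Type*} [Fintype n] [DecidableEq n]

/-- **Springer 7.2.2 (i), the Bruhat decomposition of a connected reductive group of semisimple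
rank one, discharged**: the named fact `bruhat_rankOne_of_central` of `ReductiveDualBruhat.lean`
holds — for `G` connected reductive over an algebraically closed field, `T` a maximal torus, `α`
a root with `(Ker α)°` central, `u` a root homomorphism for `α` and `m ∈ N_G(T) ∖ Z_G(T)`,
every `g ∈ G` outside `T · U_α` is `u(x) m t u(y)`. Proof: `T · U_α` is a Borel subgroup `B`
(`RankOneBorelData.borel_eq_sup` for a Borel subgroup containing it), `m ∉ B` and
`U_α ∩ m B m⁻¹ = {e}` (`eq_zero_of_conj_uval_mem`), and `G = B ∪ U_α m B`
(`RankOneBorelData.bruhat`). [cite: SpringerLAG1998, 7.2.2 (i)] -/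
theorem bruhat_rankOne_of_central_holds : bruhat_rankOne_of_central (k := k) (n := n) := by
  intro _ G T hG hT α hα hcen u hu m hmG hmN hmZ g hg hgB
  classical
  have hTt : IsTorusSubgroup T := hT.2.1
  haveI : IsMulCommutative ↥T := hTt.2.1
  set U : Subgroup (GL n k) := u.range.map G.subtype with hUdef
  -- a Borel subgroup `B ⊇ T · U_α`
  have hHconn : IsZConnected (T ⊔ U) := isZConnected_sup hTt.1 (hu.isZConnected_map_range hG.1.1)
  have hHsolv : IsSolvable ↥(T ⊔ U) := isSolvable_sup_of_le_normalizer hu.le_normalizer_map_range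
  obtain ⟨B, hB, hHB⟩ := exists_isBorelIn_ge (sup_le hT.1 (Subgroup.map_subtype_le _)) hHconn hHsolv
  have hTB : T ≤ B := le_sup_left.trans hHB
  have hUB : U ≤ B := le_sup_right.trans hHB
  -- data for some Weyl element `m'`, whence `B = T · U_α`
  obtain ⟨m', N, ρ, v, h'⟩ := exists_rankOneBorelData hG hT hα hcen hu hB hTB hUB
  have hBeq : B = T ⊔ U := h'.borel_eq_sup hG
  -- the given `m` lies outside `B = T · U_α`
  have hmB : m ∉ B := by
    rw [hBeq]
    intro hmH
    obtain ⟨t, ht, x, e⟩ := hu.mem_sup_iff.1 hmH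
    have hx : x = 0 := by
      refine hu.eq_zero_of_torus_mul_uval_mem_normalizer hTt (surjective_of_mem_roots hTt hα) ht
        fun s => ?_
      rw [← e]
      exact (Subgroup.mem_normalizer_iff''.1 hmN s).1 s.2
    rw [hx, uval_zero, mul_one] at e
    apply hmZ
    rw [e]
    exact Subgroup.mem_centralizer_iff.2 fun s hs =>
      congrArg Subtype.val (mul_comm (⟨s, hs⟩ : ↥T) ⟨t, ht⟩)
  have hZB : G ⊓ Subgroup.centralizer (T : Set (GL n k)) ≤ B :=
    centralizer_le_of_isBorelIn_holds hG.1 hT hB hTB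
  -- data for the given `m`, with the same representation
  have h : RankOneBorelData G T B α u m ρ v :=
    { h' with
      memG := hmG
      memN := hmN
      notMemB := hmB
      inter := fun y hy => eq_zero_of_conj_uval_mem hG hT hα hcen hu hB hTB hUB hZB hmG hmN hmB hy }
  -- Bruhat for `B`, and `B = T · U_α`
  have hgB' : g ∉ B := fun hgB' => hgB (by rwa [hBeq] at hgB')
  obtain ⟨y, b, hb, e⟩ := h.bruhat hg hgB'
  rw [hBeq] at hb
  obtain ⟨t, ht, x, rfl⟩ := hu.mem_sup_iff.1 hb
  refine ⟨y, x, ⟨t, ht⟩, ?_⟩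
  rw [e]
  simp only [uval, mul_assoc]

end Literature.NumberTheory.Automorphic
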